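import Summits.BirchSwinnertonDyer.BirchSwinnertonDyer.Theorems.UniversalToricDescentRelaxedDualTransfer
import Summits.BirchSwinnertonDyer.BirchSwinnertonDyer.Theorems.UniversalToricDescentRelaxedLayerTransportTorsionPrimary
import Summits.BirchSwinnertonDyer.BirchSwinnertonDyer.Theorems.UniversalToricDescentRelaxedLayerSelmer
import Summits.BirchSwinnertonDyer.BirchSwinnertonDyer.Theorems.UniversalToricDescentRelaxedLocalLevelShift
import Summits.BirchSwinnertonDyer.BirchSwinnertonDyer.Theorems.UniversalToricDescentSigmaLocalSurjective
import HarnessLib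

/-!
# The dual-term chain of the relaxed count road, lemmas at ONE or TWO layers: images in `Sel^{S′}_{𝔭′}(K_∞)[p^k]`, monotonicity,
# and the count `#(KS_n(T) / Y★) ≤ t^{p^c}` (crux ♭T≤ stmt-BirchSwinnertonDyer-23042, line `sigmacongruence`, stub R1, brick (d) part 2)

Route `UniversalToricDescent`, lead prover `bsd-wall-utd-p1` g18. THEOREMS ONLY (no definition, no named fact, no `sorry`);
`--supports stmt-BirchSwinnertonDyer-23042`. BSD is not proved by any of this.

Setting: `K` totally complex, `E = W/K` elliptic, `κ` a `ℤ_p`-extension (`Γ_n = κ⁻¹(pⁿℤ_p)`, `H = ker κ`), `k : ℕ`, `T_K` a finite set of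
finite places, a number field `L/K` with a level-`p^k` transport `(Φ^M, Φ)` for `U = Γ_n` (HYPOTHESES `hΦ`, `hdict`, `hkum`, `hshadow`,
`htors` = the conclusions of `…RelaxedLayerTransportTorsionPrimary.exists_transportTorsion_primary`), `KS_L(T)` the strict Kummer group of
`…RelaxedDualTransfer`, `Θ = h_n ∘ Φ` (`h_n = layerToInfty`).

* §1 `exists_stable_index` — an increasing sequence of subsets of a finite set is eventually constant.
* §2 `layerToInfty_transport_mem` — `y ∈ KS_L(T)`, `𝔭′ ∈ T_K` ⟹ `Θ y ∈ Sel^{S′}_{𝔭′}(K_∞, E[p^∞])` and `p^k Θ y = 0` (any `S′`).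
* §3 `image_subset_image_of_le` — for a second layer `m ≥ n` with a transport for `Γ_m` (surjective `Φ^M'`): `Θ_n(KS_L(T)) ⊆ Θ_m(KS_{L'}(T))`.
* §4 **`exists_starSubgroup`** — for a tame `v ∉ T_K` with `κ(D_v) = p^c ℤ_p`: there is `Y★ ≤ KS_L(T)`, the classes with
  `conj_{γ^i} (res_{H ≤ Γ_n} Φ^M y)` locally trivial at `v` over `K_∞` for all `i < p^c`, with
  **`#(KS_L(T)/Y★) ≤ #(E(K_{∞,η})[p^∞]/Div)^{p^c}`**: `Y★` is the kernel of `y ↦ (resKerD (conj_{γ^i} Θ^M y))_i`, whose values die in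
  `H¹(ker κ|_{D_v}, E[p^∞])` (Kummer at `v` ⟹ classical ⟹ locally trivial over `K_∞`, Greenberg Prop. 2.1), i.e. lie in the level-`p^k` Kummer
  kernel over `K_{∞,η}`, of order `≤ #(E(K_{∞,η})[p^∞]/Div)` uniformly in `k` (`…RelaxedLocalLevelShift`).

References: [GreenbergLNM1716] §2 Prop. 2.1 (p. 72), §3 Lemma 3.1 and its proof (pp. 85–87), §5 p. 114; [Castella2018] Def. 2.2;
[SerreGaloisCohomology1997] I.§2.5; [Howard2004HeegnerKolyvagin] Def. 2.1.1.
-/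

set_option linter.dupNamespace false
set_option autoImplicit false

noncomputable section
open scoped Classical
open CategoryTheory Field NumberField IsDedekindDomain Function
open Literature.NumberTheory.EllipticCurves Literature.NumberTheory.EllipticCurves.GreenbergSelmer
open Literature.NumberTheory.GaloisRepresentations
open Literature.NumberTheory.GaloisRepresentations.DiscreteGaloisModule (SelmerStructure)
open Literature.NumberTheory.GaloisCohomology
open scoped ContRepresentation
open scoped NumberField.LiesOver

namespace Summit.BirchSwinnertonDyer.BirchSwinnertonDyer.Theorems.UniversalToricDescentRelaxedDualChainLemmas

open Summit.BirchSwinnertonDyer.Rank1Residual.X11b.KummerPT Summit.BirchSwinnertonDyer.Rank1Residual.X11b.LocBridge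
  Summit.BirchSwinnertonDyer.Rank1Residual.X11b.Coinv Summit.BirchSwinnertonDyer.Rank1Residual.X11b.AcSelmer
  Summit.BirchSwinnertonDyer.BirchSwinnertonDyer.Theorems.SignedEC.RelaxedKummerCount
  Summit.BirchSwinnertonDyer.Rank1Residual.Additive
  Summit.BirchSwinnertonDyer.BirchSwinnertonDyer.Theorems.UniversalToricDescentRelaxedLayerTransportTorsion
  Summit.BirchSwinnertonDyer.BirchSwinnertonDyer.Theorems.UniversalToricDescentRelaxedDualTransfer
  Summit.BirchSwinnertonDyer.BirchSwinnertonDyer.Theorems.UniversalToricDescentRelaxedLayerSelmer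
  Summit.BirchSwinnertonDyer.BirchSwinnertonDyer.Theorems.UniversalToricDescentRelaxedLocalLevelShift
  Summit.BirchSwinnertonDyer.BirchSwinnertonDyer.Theorems.AlignedTransportAtTwoFineRoad
  Summit.BirchSwinnertonDyer.BirchSwinnertonDyer.Theorems.UniversalToricDescentKummerPow
  Summit.BirchSwinnertonDyer.BirchSwinnertonDyer.Theorems.UniversalToricDescentCofiniteDivisiblePart

/-! ## §1 Increasing chains in a finite set stabilise -/

/-- **An increasing sequence of subsets of a finite set is eventually constant.** [folklore] -/
theorem exists_stable_index {X : Type} (S : ℕ → Set X) (F : Set X) (hF : F.Finite) (hSF : ∀ n, S n ⊆ F)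
    (hmono : ∀ n m, n ≤ m → S n ⊆ S m) : ∃ N : ℕ, ∀ m, N ≤ m → S m = S N := by
  classical
  have hfin : ∀ n, (S n).Finite := fun n ↦ hF.subset (hSF n)
  -- the largest cardinality that occurs
  let P : ℕ → Prop := fun j ↦ ∃ n, (S n).ncard = j
  have hP0 : P ((S 0).ncard) := ⟨0, rfl⟩
  have hbound : ∀ n, (S n).ncard ≤ F.ncard := fun n ↦ Set.ncard_le_ncard (hSF n) hF
  obtain ⟨N, hN⟩ : P (Nat.findGreatest P F.ncard) := Nat.findGreatest_spec (hbound 0) hP0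
  refine ⟨N, fun m hm ↦ ?_⟩
  have hle : (S m).ncard ≤ (S N).ncard := by
    rw [hN]
    exact Nat.le_findGreatest (hbound m) ⟨m, rfl⟩
  exact (Set.eq_of_subset_of_ncard_le (hmono N m hm) hle (hfin m)).symm

/-! ## §2 One layer: the image of `KS_L(T)` lies in `Sel^{S′}_{𝔭′}(K_∞, E[p^∞])[p^k]` -/

section OneLayer

variable {K : Type} [Field K] [NumberField K] (W : WeierstrassCurve K) [W.IsElliptic] (p k : ℕ) [Fact p.Prime]
  (κ : ZpExtension K p) (n : ℕ) (TK : Finset (HeightOneSpectrum (𝓞 K)))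
  (L : Type) [Field L] [NumberField L] [Algebra K L]
  (ΦM : galoisCohomology ((W.baseChange L).torsionGaloisModule ((p ^ k : ℕ) : ℤ)) 1 →+
    subgroupH1 (κ.layerSubgroup n) (W.geomTorsion ((p ^ k : ℕ) : ℤ)))
  (Φ : galoisCohomology ((W.baseChange L).torsionGaloisModule ((p ^ k : ℕ) : ℤ)) 1 →+ W.subgroupH1 p (κ.layerSubgroup n))
  (hΦ : ∀ z, Φ z = resH1Hom (ContinuousMonoidHom.id (κ.layerSubgroup n))
    (AddSubgroup.inclusion (Literature.Barriers.BirchSwinnertonDyer.geomTorsion_pow_le_geomPrimaryTorsion W p k)) (fun _ _ ↦ rfl) (ΦM z))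
  (hdict : ∀ (u : HeightOneSpectrum (𝓞 K)) (z : galoisCohomology ((W.baseChange L).torsionGaloisModule ((p ^ k : ℕ) : ℤ)) 1),
    (∀ w : HeightOneSpectrum (𝓞 L), w.asIdeal.LiesOver u.asIdeal →
      galoisCohomology.localization ((W.baseChange L).torsionGaloisModule ((p ^ k : ℕ) : ℤ)) (Sum.inr w) 1 z = 0) ↔
    ∀ σ : absoluteGaloisGroup K, conjH1 (κ.layerSubgroup n) (W.geomTorsion ((p ^ k : ℕ) : ℤ)) σ (ΦM z) ∈
      awayKer (κ.layerSubgroup n) (W.geomTorsion ((p ^ k : ℕ) : ℤ)) u)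
  (hshadow : ∀ (u : HeightOneSpectrum (𝓞 K)) (z : galoisCohomology ((W.baseChange L).torsionGaloisModule ((p ^ k : ℕ) : ℤ)) 1),
    (∀ w : HeightOneSpectrum (𝓞 L), w.asIdeal.LiesOver u.asIdeal →
      galoisCohomology.localization ((W.baseChange L).torsionGaloisModule ((p ^ k : ℕ) : ℤ)) (Sum.inr w) 1 z = 0) →
    ∀ σ : absoluteGaloisGroup K, W.conjH1 p (κ.layerSubgroup n) σ (Φ z) ∈ awayKer (κ.layerSubgroup n) (W.geomPrimaryTorsion p) u)
  (htors : ∀ x, p ^ k • Φ x = 0)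
  (hkum : ∀ (u : HeightOneSpectrum (𝓞 K)) (x : galoisCohomology ((W.baseChange L).torsionGaloisModule ((p ^ k : ℕ) : ℤ)) 1),
    (∀ w : HeightOneSpectrum (𝓞 L), w.asIdeal.LiesOver u.asIdeal →
      galoisCohomology.res ((W.baseChange L).torsionGaloisModule ((p ^ k : ℕ) : ℤ)) (w.adicCompletion L) 1 x ∈
        (W.baseChange L).kummerLocalConditionAt ((p ^ k : ℕ) : ℤ) (w.adicCompletion L)) ↔
    ∀ σ : absoluteGaloisGroup K, W.conjH1 p (κ.layerSubgroup n) σ (Φ x) ∈ W.localKerOver p (κ.layerSubgroup n) (u.adicCompletion K))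
  (TL : Finset (HeightOneSpectrum (𝓞 L))) (hTL : ∀ w, w ∈ TL ↔ w.under (𝓞 K) ∈ TK)

include hdict hshadow htors hkum hTL in
/-- **`Θ y = h_n (Φ y) ∈ Sel^{S′}_{𝔭′}(K_∞, E[p^∞])` and `p^k Θ y = 0` for `y ∈ KS_L(T)`, `𝔭′ ∈ T_K`** (`K` totally complex, any `S′`):
classical at every finite `u ∉ T_K` (Kummer dictionary), locally trivial at every `u ∈ T_K` (the `E[p^∞]`-shadow of the vanishing
dictionary), which at tame `u` IS the classical condition. [cite: GreenbergLNM1716, §2 Prop. 2.1 (p. 72)] [cite: Castella2018, Def. 2.2] -/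
theorem layerToInfty_transport_mem [IsTotallyComplex K] {𝔭' : HeightOneSpectrum (𝓞 K)} (h𝔭' : 𝔭' ∈ TK)
    (S' : Set (HeightOneSpectrum (𝓞 K)))
    {y : galoisCohomology ((W.baseChange L).torsionGaloisModule ((p ^ k : ℕ) : ℤ)) 1}
    (hy : y ∈ (kummerStrict (W.baseChange L) (p ^ k) (TL.image Sum.inr ∪ Finset.univ.image Sum.inl)).selmerGroup) :
    W.layerToInfty κ n (Φ y) ∈ selmerAc W p κ 𝔭' S' ∧ p ^ k • W.layerToInfty κ n (Φ y) = 0 := by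
  obtain ⟨h1, h2⟩ := conditions_of_mem_kummerStrict W p k TK L (κ.layerSubgroup n) ΦM Φ hdict hkum TL hTL hy
  -- locally trivial at every `u ∈ T_K`, from the `E[p^∞]`-shadow
  have h2A : ∀ u ∈ TK, ∀ σ : absoluteGaloisGroup K,
      W.conjH1 p (κ.layerSubgroup n) σ (Φ y) ∈ awayKer (κ.layerSubgroup n) (W.geomPrimaryTorsion p) u :=
    fun u hu ↦ hshadow u y ((hdict u y).mpr (h2 u hu))
  refine ⟨layerToInfty_mem_selmerAc_of W p κ S' 𝔭' n (Φ y) (fun u hu _ σ ↦ ?_) (h2A 𝔭' h𝔭'), ?_⟩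
  · by_cases huT : u ∈ TK
    · rw [localKerOver_layer_eq_awayKer W p κ n hu]
      exact h2A u huT σ
    · exact h1 u huT σ
  · rw [← map_nsmul, htors, map_zero]

end OneLayer

/-! ## §3 Two layers: monotonicity of the images -/

section TwoLayers

variable {K : Type} [Field K] [NumberField K] (W : WeierstrassCurve K) [W.IsElliptic] (p k : ℕ) [Fact p.Prime]
  (κ : ZpExtension K p) (TK : Finset (HeightOneSpectrum (𝓞 K)))

omit [W.IsElliptic] in
/-- **`Θ_n(KS_L(T)) ⊆ Θ_m(KS_{L'}(T))` for `n ≤ m`** (transports for `Γ_n` over `L` and for `Γ_m` over `L'`, the latter with surjective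
`Φ^M'`; `L'` totally complex): the transfer `y'` of `…RelaxedDualTransfer.exists_transfer` has `Φ' y' = res (Φ y)`, and
`h_m ∘ res_{Γ_m ≤ Γ_n} = h_n`. [cite: GreenbergLNM1716, §3 (proof of Lemma 3.1)] -/
theorem image_subset_image_of_le {n m : ℕ} (hnm : n ≤ m)
    (L : Type) [Field L] [NumberField L] [Algebra K L]
    (ΦM : galoisCohomology ((W.baseChange L).torsionGaloisModule ((p ^ k : ℕ) : ℤ)) 1 →+
      subgroupH1 (κ.layerSubgroup n) (W.geomTorsion ((p ^ k : ℕ) : ℤ)))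
    (Φ : galoisCohomology ((W.baseChange L).torsionGaloisModule ((p ^ k : ℕ) : ℤ)) 1 →+ W.subgroupH1 p (κ.layerSubgroup n))
    (hΦ : ∀ z, Φ z = resH1Hom (ContinuousMonoidHom.id (κ.layerSubgroup n))
      (AddSubgroup.inclusion (Literature.Barriers.BirchSwinnertonDyer.geomTorsion_pow_le_geomPrimaryTorsion W p k)) (fun _ _ ↦ rfl)
      (ΦM z))
    (hdict : ∀ (u : HeightOneSpectrum (𝓞 K)) (z : galoisCohomology ((W.baseChange L).torsionGaloisModule ((p ^ k : ℕ) : ℤ)) 1),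
      (∀ w : HeightOneSpectrum (𝓞 L), w.asIdeal.LiesOver u.asIdeal →
        galoisCohomology.localization ((W.baseChange L).torsionGaloisModule ((p ^ k : ℕ) : ℤ)) (Sum.inr w) 1 z = 0) ↔
      ∀ σ : absoluteGaloisGroup K, conjH1 (κ.layerSubgroup n) (W.geomTorsion ((p ^ k : ℕ) : ℤ)) σ (ΦM z) ∈
        awayKer (κ.layerSubgroup n) (W.geomTorsion ((p ^ k : ℕ) : ℤ)) u)
    (hkum : ∀ (u : HeightOneSpectrum (𝓞 K)) (x : galoisCohomology ((W.baseChange L).torsionGaloisModule ((p ^ k : ℕ) : ℤ)) 1),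
      (∀ w : HeightOneSpectrum (𝓞 L), w.asIdeal.LiesOver u.asIdeal →
        galoisCohomology.res ((W.baseChange L).torsionGaloisModule ((p ^ k : ℕ) : ℤ)) (w.adicCompletion L) 1 x ∈
          (W.baseChange L).kummerLocalConditionAt ((p ^ k : ℕ) : ℤ) (w.adicCompletion L)) ↔
      ∀ σ : absoluteGaloisGroup K,
        W.conjH1 p (κ.layerSubgroup n) σ (Φ x) ∈ W.localKerOver p (κ.layerSubgroup n) (u.adicCompletion K))
    (TL : Finset (HeightOneSpectrum (𝓞 L))) (hTL : ∀ w, w ∈ TL ↔ w.under (𝓞 K) ∈ TK)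
    (L' : Type) [Field L'] [NumberField L'] [Algebra K L'] (hL' : ∀ w : InfinitePlace L', w.IsComplex)
    (ΦM' : galoisCohomology ((W.baseChange L').torsionGaloisModule ((p ^ k : ℕ) : ℤ)) 1 →+
      subgroupH1 (κ.layerSubgroup m) (W.geomTorsion ((p ^ k : ℕ) : ℤ)))
    (Φ' : galoisCohomology ((W.baseChange L').torsionGaloisModule ((p ^ k : ℕ) : ℤ)) 1 →+ W.subgroupH1 p (κ.layerSubgroup m))
    (hΦ' : ∀ z, Φ' z = resH1Hom (ContinuousMonoidHom.id (κ.layerSubgroup m))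
      (AddSubgroup.inclusion (Literature.Barriers.BirchSwinnertonDyer.geomTorsion_pow_le_geomPrimaryTorsion W p k)) (fun _ _ ↦ rfl)
      (ΦM' z))
    (hsurj' : Function.Surjective ΦM')
    (hdict' : ∀ (u : HeightOneSpectrum (𝓞 K)) (z : galoisCohomology ((W.baseChange L').torsionGaloisModule ((p ^ k : ℕ) : ℤ)) 1),
      (∀ w : HeightOneSpectrum (𝓞 L'), w.asIdeal.LiesOver u.asIdeal →
        galoisCohomology.localization ((W.baseChange L').torsionGaloisModule ((p ^ k : ℕ) : ℤ)) (Sum.inr w) 1 z = 0) ↔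
      ∀ σ : absoluteGaloisGroup K, conjH1 (κ.layerSubgroup m) (W.geomTorsion ((p ^ k : ℕ) : ℤ)) σ (ΦM' z) ∈
        awayKer (κ.layerSubgroup m) (W.geomTorsion ((p ^ k : ℕ) : ℤ)) u)
    (hkum' : ∀ (u : HeightOneSpectrum (𝓞 K)) (x : galoisCohomology ((W.baseChange L').torsionGaloisModule ((p ^ k : ℕ) : ℤ)) 1),
      (∀ w : HeightOneSpectrum (𝓞 L'), w.asIdeal.LiesOver u.asIdeal →
        galoisCohomology.res ((W.baseChange L').torsionGaloisModule ((p ^ k : ℕ) : ℤ)) (w.adicCompletion L') 1 x ∈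
          (W.baseChange L').kummerLocalConditionAt ((p ^ k : ℕ) : ℤ) (w.adicCompletion L')) ↔
      ∀ σ : absoluteGaloisGroup K,
        W.conjH1 p (κ.layerSubgroup m) σ (Φ' x) ∈ W.localKerOver p (κ.layerSubgroup m) (u.adicCompletion K))
    (TL' : Finset (HeightOneSpectrum (𝓞 L'))) (hTL' : ∀ w, w ∈ TL' ↔ w.under (𝓞 K) ∈ TK) :
    (fun y ↦ W.layerToInfty κ n (Φ y)) ''
        ((kummerStrict (W.baseChange L) (p ^ k) (TL.image Sum.inr ∪ Finset.univ.image Sum.inl)).selmerGroup : Set _) ⊆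
      (fun y ↦ W.layerToInfty κ m (Φ' y)) ''
        ((kummerStrict (W.baseChange L') (p ^ k) (TL'.image Sum.inr ∪ Finset.univ.image Sum.inl)).selmerGroup : Set _) := by
  rintro _ ⟨y, hy, rfl⟩
  obtain ⟨y', hy', -, hΦy'⟩ := exists_transfer W p k TK L (κ.layerSubgroup n) ΦM Φ hΦ hdict hkum TL hTL L' (κ.layerSubgroup m)
    (κ.layerSubgroup_antitone hnm) ΦM' Φ' hΦ' hsurj' hdict' hkum' TL' hTL' hL' hy
  refine ⟨y', hy', ?_⟩
  change W.layerToInfty κ m (Φ' y') = W.layerToInfty κ n (Φ y)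
  -- `h_m ∘ res_{Γ_m ≤ Γ_n} = h_n` (the tree's `FineSelmerLeSignedSelmer.layerToInfty_resOfLe_layer`, inlined)
  have h := congrArg (fun f ↦ f (Φ y)) (W.resOfLe_comp_holds p (κ.kerSubgroup_le_layerSubgroup m) (κ.layerSubgroup_antitone hnm))
  simp only [AddMonoidHom.coe_comp, Function.comp_apply] at h
  rw [hΦy']
  exact h

end TwoLayers

/-! ## §4 One layer: the subgroup `Y★` and the count `#(KS_L(T)/Y★) ≤ t^{p^c}` -/

section Star

variable {K : Type} [Field K] [NumberField K] (W : WeierstrassCurve K) [W.IsElliptic] (p k : ℕ) [Fact p.Prime]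
  (κ : ZpExtension K p) (n : ℕ) (TK : Finset (HeightOneSpectrum (𝓞 K)))
  (L : Type) [Field L] [NumberField L] [Algebra K L]
  (ΦM : galoisCohomology ((W.baseChange L).torsionGaloisModule ((p ^ k : ℕ) : ℤ)) 1 →+
    subgroupH1 (κ.layerSubgroup n) (W.geomTorsion ((p ^ k : ℕ) : ℤ)))
  (Φ : galoisCohomology ((W.baseChange L).torsionGaloisModule ((p ^ k : ℕ) : ℤ)) 1 →+ W.subgroupH1 p (κ.layerSubgroup n))
  (hΦ : ∀ z, Φ z = resH1Hom (ContinuousMonoidHom.id (κ.layerSubgroup n))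
    (AddSubgroup.inclusion (Literature.Barriers.BirchSwinnertonDyer.geomTorsion_pow_le_geomPrimaryTorsion W p k)) (fun _ _ ↦ rfl) (ΦM z))
  (hdict : ∀ (u : HeightOneSpectrum (𝓞 K)) (z : galoisCohomology ((W.baseChange L).torsionGaloisModule ((p ^ k : ℕ) : ℤ)) 1),
    (∀ w : HeightOneSpectrum (𝓞 L), w.asIdeal.LiesOver u.asIdeal →
      galoisCohomology.localization ((W.baseChange L).torsionGaloisModule ((p ^ k : ℕ) : ℤ)) (Sum.inr w) 1 z = 0) ↔
    ∀ σ : absoluteGaloisGroup K, conjH1 (κ.layerSubgroup n) (W.geomTorsion ((p ^ k : ℕ) : ℤ)) σ (ΦM z) ∈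
      awayKer (κ.layerSubgroup n) (W.geomTorsion ((p ^ k : ℕ) : ℤ)) u)
  (hkum : ∀ (u : HeightOneSpectrum (𝓞 K)) (x : galoisCohomology ((W.baseChange L).torsionGaloisModule ((p ^ k : ℕ) : ℤ)) 1),
    (∀ w : HeightOneSpectrum (𝓞 L), w.asIdeal.LiesOver u.asIdeal →
      galoisCohomology.res ((W.baseChange L).torsionGaloisModule ((p ^ k : ℕ) : ℤ)) (w.adicCompletion L) 1 x ∈
        (W.baseChange L).kummerLocalConditionAt ((p ^ k : ℕ) : ℤ) (w.adicCompletion L)) ↔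
    ∀ σ : absoluteGaloisGroup K, W.conjH1 p (κ.layerSubgroup n) σ (Φ x) ∈ W.localKerOver p (κ.layerSubgroup n) (u.adicCompletion K))
  (TL : Finset (HeightOneSpectrum (𝓞 L))) (hTL : ∀ w, w ∈ TL ↔ w.under (𝓞 K) ∈ TK)

include hΦ hdict hkum hTL in
/-- **The subgroup `Y★ ≤ KS_L(T)` and the count `#(KS_L(T)/Y★) ≤ #(E(K_{∞,η})[p^∞]/Div)^{p^c}`** (module docstring, §4).
[cite: GreenbergLNM1716, §2 Prop. 2.1 (p. 72), §3 proof of Lemma 3.1 (p. 86), §5 p. 114] [cite: SerreGaloisCohomology1997, I.§2.5] -/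
theorem exists_starSubgroup {v : HeightOneSpectrum (𝓞 K)} (hpv : ((p : ℕ) : 𝓞 K) ∉ v.asIdeal) (hvT : v ∉ TK) (γ : absoluteGaloisGroup K)
    (c : ℕ) {D : AddSubgroup (FixedPoints.addSubgroup (kerD κ v) (W.geomPrimaryTorsion p))}
    (hDmem : ∀ b, b ∈ D ↔ ∀ j : ℕ, ∃ b', p ^ j • b' = b) (hDdiv : ∀ d ∈ D, ∃ d' ∈ D, p • d' = d)
    [Finite (FixedPoints.addSubgroup (kerD κ v) (W.geomPrimaryTorsion p) ⧸ D)] :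
    ∃ Ystar : AddSubgroup ((kummerStrict (W.baseChange L) (p ^ k) (TL.image Sum.inr ∪ Finset.univ.image Sum.inl)).selmerGroup),
      (∀ y, y ∈ Ystar ↔ ∀ i : ℕ, i < p ^ c →
        conjH1 κ.kerSubgroup (W.geomTorsion ((p ^ k : ℕ) : ℤ)) (γ ^ i)
            (resOfLe (W.geomTorsion ((p ^ k : ℕ) : ℤ)) (κ.kerSubgroup_le_layerSubgroup n) (ΦM y)) ∈
          awayKer κ.kerSubgroup (W.geomTorsion ((p ^ k : ℕ) : ℤ)) v) ∧
      Nat.card ((kummerStrict (W.baseChange L) (p ^ k) (TL.image Sum.inr ∪ Finset.univ.image Sum.inl)).selmerGroup ⧸ Ystar) ≤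
        Nat.card (FixedPoints.addSubgroup (kerD κ v) (W.geomPrimaryTorsion p) ⧸ D) ^ (p ^ c) := by
  classical
  set M := W.geomTorsion ((p ^ k : ℕ) : ℤ) with hM
  set KS := (kummerStrict (W.baseChange L) (p ^ k) (TL.image Sum.inr ∪ Finset.univ.image Sum.inl)).selmerGroup with hKS
  -- the level-`p^k` Kummer kernel over `K_{∞,η}` and its size
  set incl : subgroupH1 (kerD κ v) M →+ subgroupH1 (kerD κ v) (W.geomPrimaryTorsion p) :=
    resH1Hom (ContinuousMonoidHom.id (kerD κ v))
      (AddSubgroup.inclusion (Literature.Barriers.BirchSwinnertonDyer.geomTorsion_pow_le_geomPrimaryTorsion W p k)) (fun _ _ ↦ rfl)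
    with hincl
  have hcardK : Nat.card incl.ker ≤ Nat.card (FixedPoints.addSubgroup (kerD κ v) (W.geomPrimaryTorsion p) ⧸ D) :=
    natCard_ker_torsionToPrimary_kerD_le κ W v hDmem hDdiv k
  haveI hKfin : Finite incl.ker := by
    apply Nat.finite_of_card_ne_zero
    rw [hincl, natCard_ker_kummerPow_eq_natCard_quotient W p (kerD κ v) k]
    have h := (natCard_quotient_nsmul_range_le (Fact.out : p.Prime)
      (exists_pow_smul_fixedPoints_kerD_eq_zero κ W v) (finite_setOf_fixedPoints_kerD_smul_eq_zero κ W v) hDmem hDdiv k).1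
    have e : (DistribSMul.toAddMonoidHom (FixedPoints.addSubgroup (kerD κ v) (W.geomPrimaryTorsion p)) (p ^ k)).range =
        (nsmulAddMonoidHom (α := FixedPoints.addSubgroup (kerD κ v) (W.geomPrimaryTorsion p)) (p ^ k)).range :=
      congrArg AddMonoidHom.range (AddMonoidHom.ext fun _ ↦ rfl)
    rw [e]
    haveI := h
    exact Nat.card_pos.ne'
  -- the map `ρ : KS → (Fin p^c → H¹(ker κ|_{D_v}, E[p^k]))`
  let ΘM : galoisCohomology ((W.baseChange L).torsionGaloisModule ((p ^ k : ℕ) : ℤ)) 1 →+ subgroupH1 κ.kerSubgroup M :=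
    (resOfLe M (κ.kerSubgroup_le_layerSubgroup n)).comp ΦM
  let ρi : Fin (p ^ c) → (galoisCohomology ((W.baseChange L).torsionGaloisModule ((p ^ k : ℕ) : ℤ)) 1 →+ subgroupH1 (kerD κ v) M) :=
    fun i ↦ (resKerD κ M v).comp ((conjH1 κ.kerSubgroup M (γ ^ (i : ℕ))).comp ΘM)
  let ρ : KS →+ (Fin (p ^ c) → subgroupH1 (kerD κ v) M) := (AddMonoidHom.pi ρi).comp KS.subtype
  have hρ : ∀ (y : KS) (i : Fin (p ^ c)), ρ y i = resKerD κ M v (conjH1 κ.kerSubgroup M (γ ^ (i : ℕ)) (resOfLe M (κ.kerSubgroup_le_layerSubgroup n)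
      (ΦM (y : galoisCohomology ((W.baseChange L).torsionGaloisModule ((p ^ k : ℕ) : ℤ)) 1)))) := fun _ _ ↦ rfl
  -- the values of `ρ` die in `H¹(ker κ|_{D_v}, E[p^∞])`
  have hval : ∀ (y : KS) (i : Fin (p ^ c)), ρ y i ∈ incl.ker := by
    intro y i
    rw [AddMonoidHom.mem_ker, hρ, hincl]
    obtain ⟨h1, -⟩ := conditions_of_mem_kummerStrict W p k TK L (κ.layerSubgroup n) ΦM Φ hdict hkum TL hTL y.2
    -- `incl (resKerD (conj (res ΦM y))) = resKerD (conj (h_n (Φ y)))`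
    have e1 : resH1Hom (ContinuousMonoidHom.id (kerD κ v))
          (AddSubgroup.inclusion (Literature.Barriers.BirchSwinnertonDyer.geomTorsion_pow_le_geomPrimaryTorsion W p k)) (fun _ _ ↦ rfl)
          (resKerD κ M v (conjH1 κ.kerSubgroup M (γ ^ (i : ℕ)) (resOfLe M (κ.kerSubgroup_le_layerSubgroup n)
            (ΦM (y : galoisCohomology ((W.baseChange L).torsionGaloisModule ((p ^ k : ℕ) : ℤ)) 1))))) =
        resKerD κ (W.geomPrimaryTorsion p) v (W.conjH1 p κ.kerSubgroup (γ ^ (i : ℕ)) (W.layerToInfty κ n (Φ y))) := by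
      rw [hΦ, WeierstrassCurve.layerToInfty, WeierstrassCurve.resOfLe, WeierstrassCurve.conjH1,
        resOfLe_resH1Hom_id (AddSubgroup.inclusion (Literature.Barriers.BirchSwinnertonDyer.geomTorsion_pow_le_geomPrimaryTorsion W p k))
          (fun _ _ ↦ rfl),
        conjH1_resH1Hom_id (AddSubgroup.inclusion (Literature.Barriers.BirchSwinnertonDyer.geomTorsion_pow_le_geomPrimaryTorsion W p k))
          (fun _ _ ↦ rfl)]
      rw [resKerD, resKerD, resH1Hom_resH1Hom, resH1Hom_resH1Hom]
      exact DFunLike.congr_fun (resH1Hom_congr (by ext; rfl) (by ext; rfl) _ _) _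
    rw [e1, ← mem_awayKer_iff_resKerD_eq_zero]
    -- Kummer at the places over `v` ⟹ classical at `v` over `Γ_n` ⟹ over `ker κ` ⟹ locally trivial (`v ∤ p`)
    have hcl := h1 v hvT (γ ^ (i : ℕ))
    have e2 := congrArg (fun f ↦ f (Φ y)) (resOfLe_comp_conjH1_holds (M := W.geomPrimaryTorsion p) (κ.kerSubgroup_le_layerSubgroup n)
      (γ ^ (i : ℕ)))
    simp only [AddMonoidHom.coe_comp, Function.comp_apply] at e2
    change W.conjH1 p κ.kerSubgroup (γ ^ (i : ℕ)) (W.resOfLe p (κ.kerSubgroup_le_layerSubgroup n) (Φ y)) ∈ _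
    rw [← e2]
    exact localKerOver_le_awayKer p κ v W hpv (W.resOfLe_mem_localKerOver p _ (κ.kerSubgroup_le_layerSubgroup n) hcl)
  refine ⟨ρ.ker, fun y ↦ ?_, ?_⟩
  · -- membership in `ker ρ`
    rw [AddMonoidHom.mem_ker]
    constructor
    · intro h i hi
      rw [mem_awayKer_iff_resKerD_eq_zero, ← hρ y ⟨i, hi⟩, h]
      rfl
    · intro h
      funext i
      rw [hρ]
      exact (mem_awayKer_iff_resKerD_eq_zero κ v _).mp (h i i.2)
  · -- the count through `KS/ker ρ ≃ range ρ ↪ (Fin p^c → ker incl)`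
    let j : ρ.range → (Fin (p ^ c) → incl.ker) := fun x i ↦ ⟨(x : Fin (p ^ c) → subgroupH1 (kerD κ v) M) i, by
      obtain ⟨y, hy⟩ := x.2
      rw [← hy]
      exact hval y i⟩
    have hj : Function.Injective j := by
      intro a b h
      apply Subtype.ext
      funext i
      exact congrArg (fun f : Fin (p ^ c) → incl.ker ↦ ((f i : incl.ker) : subgroupH1 (kerD κ v) M)) h
    haveI : Finite (Fin (p ^ c) → incl.ker) := inferInstance
    calc Nat.card (KS ⧸ ρ.ker) = Nat.card ρ.range := Nat.card_congr (QuotientAddGroup.quotientKerEquivRange ρ).toEquiv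
      _ ≤ Nat.card (Fin (p ^ c) → incl.ker) := Nat.card_le_card_of_injective j hj
      _ = Nat.card incl.ker ^ (p ^ c) := by rw [Nat.card_fun, Nat.card_eq_fintype_card (α := Fin (p ^ c)), Fintype.card_fin]
      _ ≤ Nat.card (FixedPoints.addSubgroup (kerD κ v) (W.geomPrimaryTorsion p) ⧸ D) ^ (p ^ c) := Nat.pow_le_pow_left hcardK _

end Star

end Summit.BirchSwinnertonDyer.BirchSwinnertonDyer.Theorems.UniversalToricDescentRelaxedDualChainLemmas

end
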